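import Summits.HodgeConjecture.HodgeConjecture.Theorems.F0P3cStCharTSOpenCellFactorisationThree
import HarnessLib

/-!
# F0 · P3c · line LH6 «StCharTS» — complements to «OPEN-CELL FACTORISATION FOR `Φ₃`★»: the inverse of the lower factor, the
# closed form `U = w₀ · n · L⁻¹`, the transferred norm relation, and the `Φ₃`-unitarity of `U` («BIG-CELL COMPLEMENTS»)

Cell `pub/hodgecm-mathlib`, crux H413 = `stmt-HodgeConjecture-24833` (lane `--supports … --as helper`); seat F0P2-p02 (g24); GENERIC
base layer under LEAD F0P3a-plan (g15) STANDING RULE 20 (T14-67).  THEOREMS ONLY (0 def ∕ 0 instance ∕ 0 notation ∕ 0 sorry);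
imports ★ `F0P3cStCharTSOpenCellFactorisationThree` (F0P2-p06 (g20): the identity `w₀ · n(a,b) = U · L` itself, `det U = −1`, the
shape read-backs) + HarnessLib only.  Same CONVENTION-FREE letters as that file: six ring elements `a a' b b' bi b'i` with
`b + b' + a a' = 0`, `b bi = 1`, `b' b'i = 1` (read `a' = ā`, `b' = b̄`, `bi = b⁻¹`, `b'i = b̄⁻¹` in `U(Φ₃)(E_v)`), `w₀ = antidiag(1,1,1)`,
`n(a, b) = [[1,a,b],[0,1,−a'],[0,0,1]]`, `U = [[b'i, −a bi, 1],[0, −b' bi, −a'],[0,0,b]]`, `L = [[1,0,0],[−a' b'i,1,0],[bi, a bi, 1]]`.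

* §1 THE LOWER FACTOR IS A CONJUGATED HEISENBERG MATRIX: `L = w₀ · n(a bi, bi) · w₀` with the conjugate parameter `a' b'i`
  (`lower_factor_eq_antidiagonal_conj`), and its parameters satisfy the SAME norm relation
  `bi + b'i + (a bi)(a' b'i) = 0` (`norm_relation_of_lower_factor`) — so `L ∈ w₀ N w₀ = N̄` whenever `n(a,b) ∈ N`.
* §2 THE INVERSE OF `L` IN CLOSED FORM: `L · L′ = 1 = L′ · L` with `L′ = [[1,0,0],[a' b'i,1,0],[b'i, −a bi, 1]] = w₀ · n(−a bi, b'i) · w₀`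
  (`lower_factor_mul_inv`, `lower_factor_inv_mul`); hence **`U = w₀ · n(a,b) · L′`** (`upper_factor_eq`), the `B`-part of `w₀ n`
  as an explicit product.
* §3 `U` IS `Φ₃`-UNITARY: for a ring endomorphism `σ` exchanging `a ↔ a'`, `b ↔ b'`, `bi ↔ b'i` (the conjugation),
  `(σU)ᵀ · Φ₃ · U = Φ₃` (`upper_factor_unitary`) — so `U ∈ B ∩ U(σ, Φ₃)`, the memo's «`U ∈ unitaryGroupOfForm` (automatic)» made
  explicit; and the diagonal of `U` satisfies the torus relations `σ(U₀₀) U₂₂ = 1`, `σ(U₁₁) U₁₁ = 1` (`upper_factor_diag_relations`: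
  `U = d(α, β, ᾱ⁻¹) · (unipotent)` with `β ∈ E¹`).

CONSUMER-IN-WAITING (rule 20): MEMO-KEYS3 v2 T4∕T5 (`f₀(w₀ n(a,b)) = (χ δ^{1∕2})(U) · 𝟙[L ∈ K′]` needs `U ∈ B ∩ U(Φ₃)`, the torus
coordinates of `U`, and `L ∈ N̄` with its coordinates and inverse for the change of variables in the two-shell tail); reusable by any
explicit open-cell computation on `U(Φ₃)`.  HONEST LABEL: count-neutral generic algebra; HC_CM is proved only modulo the 7 printed
citations (2 remaining named inputs hLiu418 = `stmt-HodgeConjecture-24832`, h413 = `stmt-HodgeConjecture-24833`) until rung 0 closes.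

## References
* [Rogawski1990] J. D. Rogawski, *Automorphic Representations of Unitary Groups in Three Variables* (1990), §1.10 p. 9 (`N = {u(x,z)}`,
  `M = {d(α, β, ᾱ⁻¹)}`, `w`), §6.2 proof of Prop. 6.2.1 p. 81 (the `GL₃` computation of the torus part of `w u(x, z)`).
-/

set_option autoImplicit false
-- the mandated namespace has the single-problem summit's repeated segment (`HodgeConjecture.HodgeConjecture`)
set_option linter.dupNamespace false

namespace Summit.HodgeConjecture.HodgeConjecture.Cruxes.H413.F0P3cStCharTSBigCellComplements

open Summit.HodgeConjecture.HodgeConjecture.Cruxes.H413.F0P3cStCharTSOpenCellFactorisationThree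
open scoped Matrix

variable {R : Type*} [CommRing R]

/-! ## §1 The lower factor is `w₀ · n(a bi, bi) · w₀` and satisfies the same norm relation -/

/-- `L = w₀ · n(a bi, bi) · w₀`: the lower factor is the `w₀`-conjugate of the Heisenberg matrix with parameters `(a bi, bi)` and
conjugate parameter `a' b'i` (conjugation by `w₀` reverses rows and columns). [cite: Rogawski1990, §1.10 p. 9] -/
theorem lower_factor_eq_antidiagonal_conj (a a' bi b'i : R) :
    (!![(1 : R), 0, 0; -(a' * b'i), 1, 0; bi, a * bi, 1] : Matrix (Fin 3) (Fin 3) R) =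
      !![(0 : R), 0, 1; 0, 1, 0; 1, 0, 0] * !![1, a * bi, bi; 0, 1, -(a' * b'i); 0, 0, 1] * !![(0 : R), 0, 1; 0, 1, 0; 1, 0, 0] := by
  ext i j
  fin_cases i <;> fin_cases j <;> simp [Matrix.mul_apply, Fin.sum_univ_three]

/-- **THE NORM RELATION TRANSFERS TO THE LOWER FACTOR**: `bi + b'i + (a bi)(a' b'i) = 0` (multiply `b + b' + a a' = 0` by
`bi b'i`) — the parameters of `L = w₀ n(a bi, bi) w₀` satisfy the relation defining `N`, so `L ∈ w₀ N w₀`.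
[cite: Rogawski1990, §1.10 p. 9] -/
theorem norm_relation_of_lower_factor (a a' b b' bi b'i : R) (hrel : b + b' + a * a' = 0) (hb : b * bi = 1)
    (hb' : b' * b'i = 1) : bi + b'i + (a * bi) * (a' * b'i) = 0 := by
  linear_combination (bi * b'i) * hrel - b'i * hb - bi * hb'

/-! ## §2 The inverse of the lower factor and the closed form `U = w₀ · n(a,b) · L⁻¹` -/

/-- **`L · L′ = 1`** with `L′ = [[1,0,0],[a' b'i, 1, 0],[b'i, −a bi, 1]]` (= `w₀ n(−a bi, b'i) w₀`), under the three relations.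
[cite: Rogawski1990, §1.10 p. 9] -/
theorem lower_factor_mul_inv (a a' b b' bi b'i : R) (hrel : b + b' + a * a' = 0) (hb : b * bi = 1) (hb' : b' * b'i = 1) :
    !![(1 : R), 0, 0; -(a' * b'i), 1, 0; bi, a * bi, 1] * !![(1 : R), 0, 0; a' * b'i, 1, 0; b'i, -(a * bi), 1] = 1 := by
  have h := norm_relation_of_lower_factor a a' b b' bi b'i hrel hb hb'
  ext i j
  fin_cases i <;> fin_cases j <;> simp [Matrix.mul_apply, Fin.sum_univ_three]
  linear_combination h

/-- **`L′ · L = 1`**: the inverse is two-sided. [cite: Rogawski1990, §1.10 p. 9] -/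
theorem lower_factor_inv_mul (a a' b b' bi b'i : R) (hrel : b + b' + a * a' = 0) (hb : b * bi = 1) (hb' : b' * b'i = 1) :
    !![(1 : R), 0, 0; a' * b'i, 1, 0; b'i, -(a * bi), 1] * !![(1 : R), 0, 0; -(a' * b'i), 1, 0; bi, a * bi, 1] = 1 := by
  have h := norm_relation_of_lower_factor a a' b b' bi b'i hrel hb hb'
  ext i j
  fin_cases i <;> fin_cases j <;> simp [Matrix.mul_apply, Fin.sum_univ_three]
  linear_combination h

/-- `L′` is itself a conjugated Heisenberg matrix: `L′ = w₀ · n(−a bi, b'i) · w₀` (conjugate parameter `−a' b'i`).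
[cite: Rogawski1990, §1.10 p. 9] -/
theorem lower_factor_inv_eq_antidiagonal_conj (a a' bi b'i : R) :
    (!![(1 : R), 0, 0; a' * b'i, 1, 0; b'i, -(a * bi), 1] : Matrix (Fin 3) (Fin 3) R) =
      !![(0 : R), 0, 1; 0, 1, 0; 1, 0, 0] * !![1, -(a * bi), b'i; 0, 1, -(-(a' * b'i)); 0, 0, 1] *
        !![(0 : R), 0, 1; 0, 1, 0; 1, 0, 0] := by
  ext i j
  fin_cases i <;> fin_cases j <;> simp [Matrix.mul_apply, Fin.sum_univ_three]

/-- **THE UPPER FACTOR IN CLOSED FORM: `U = w₀ · n(a,b) · L′`** (the `B`-component of the open-cell element `w₀ n(a,b)` in `B · N̄`).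
[cite: Rogawski1990, §6.2 Prop. 6.2.1 (proof) p. 81] [cite: Rogawski1990, §1.10 p. 9] -/
theorem upper_factor_eq (a a' b b' bi b'i : R) (hrel : b + b' + a * a' = 0) (hb : b * bi = 1) (hb' : b' * b'i = 1) :
    (!![b'i, -(a * bi), 1; 0, -(b' * bi), -a'; 0, 0, b] : Matrix (Fin 3) (Fin 3) R) =
      !![(0 : R), 0, 1; 0, 1, 0; 1, 0, 0] * !![1, a, b; 0, 1, -a'; 0, 0, 1] * !![(1 : R), 0, 0; a' * b'i, 1, 0; b'i, -(a * bi), 1] := by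
  rw [antidiagonal_mul_unipotent_eq_upper_mul_lower a a' b b' bi b'i hrel hb hb', Matrix.mul_assoc,
    lower_factor_mul_inv a a' b b' bi b'i hrel hb hb', Matrix.mul_one]

/-! ## §3 `U` is `Φ₃`-unitary; the torus relations of its diagonal -/

/-- **`U ∈ U(σ, Φ₃)`**: if the ring endomorphism `σ` exchanges `a ↔ a'`, `b ↔ b'`, `bi ↔ b'i` (the conjugation of `E_v`, with
`a' = ā`, …), then `(σ U)ᵀ · Φ₃ · U = Φ₃` — the upper factor lies in the Borel subgroup of the unitary group, not merely in the
upper-triangular group of `GL₃`. [cite: Rogawski1990, §1.10 p. 9] -/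
theorem upper_factor_unitary (σ : R →+* R) (a a' b b' bi b'i : R) (hrel : b + b' + a * a' = 0) (hb : b * bi = 1)
    (hb' : b' * b'i = 1) (ha : σ a = a') (ha' : σ a' = a) (hσb : σ b = b') (hσb' : σ b' = b) (hσbi : σ bi = b'i)
    (hσb'i : σ b'i = bi) :
    (!![b'i, -(a * bi), 1; 0, -(b' * bi), -a'; 0, 0, b].map σ)ᵀ * !![(0 : R), 0, 1; 0, 1, 0; 1, 0, 0] *
        !![b'i, -(a * bi), 1; 0, -(b' * bi), -a'; 0, 0, b] = !![(0 : R), 0, 1; 0, 1, 0; 1, 0, 0] := by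
  ext i j
  fin_cases i <;> fin_cases j <;>
    simp [Matrix.mul_apply, Fin.sum_univ_three, Matrix.map_apply, Matrix.transpose_apply, map_neg, map_mul, map_one,
      ha, ha', hσb, hσb', hσbi, hσb'i] <;>
    first
      | linear_combination hb'
      | linear_combination hb
      | linear_combination hrel
      | linear_combination (b' * b'i) * hb + hb'
      | linear_combination (bi * b'i) * hrel - b'i * hb - bi * hb'
      | linear_combination (a' * bi) * hb'
      | linear_combination (a * b'i) * hb
      | linear_combination (-bi) * hrel + hb
      | linear_combination (-b'i) * hrel + hb'
      | ring1

/-- **TORUS RELATIONS OF THE DIAGONAL** `(b'i, −b' bi, b)` of `U`: `σ(U₀₀) · U₂₂ = bi · b = 1` and `σ(U₁₁) · U₁₁ = (b b'i)(b' bi) = 1`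
— i.e. `U ∈ d(α, β, ᾱ⁻¹) · N` with `α = b'i = b̄⁻¹` and `β = −b' bi = −b̄∕b` of norm one.
[cite: Rogawski1990, §1.10 p. 9] [cite: Rogawski1990, §6.2 Prop. 6.2.1 (proof) p. 81] -/
theorem upper_factor_diag_relations (b b' bi b'i : R) (hb : b * bi = 1) (hb' : b' * b'i = 1) :
    bi * b = 1 ∧ (-(b * b'i)) * (-(b' * bi)) = 1 := by
  refine ⟨by linear_combination hb, by linear_combination (b' * b'i) * hb + hb'⟩

end Summit.HodgeConjecture.HodgeConjecture.Cruxes.H413.F0P3cStCharTSBigCellComplements
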